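import Literature.AlgebraicGeometry.HodgeTheory.SymmetricA3NormalFormChart
import Literature.AlgebraicGeometry.HodgeTheory.NodalPencilJointSubmersion
import Mathlib.FieldTheory.IsAlgClosed.Basic
import HarnessLib

/-!
# The `A₃` chart of the pencil coordinate of the monomial pencil `f₁ + c·x_j^d` at a symmetric `A₃` point

Family `hodge`, layer `Literature/AlgebraicGeometry/HodgeTheory`, sequel of `SymmetricA3NormalFormChart` (the `A₃` normal form
`Σᵢ (Θ y)ᵢ^{aᵢ} = f₁(e_j + ins_j 0 y)`, `a = (2, …, 2, 4)`) and the `A₃` analogue of `NodalPencilMorseChart` (the same statement at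
an ordinary double point with `a = (2, …, 2)`).  Written by the prover seat `hodge-nonav-prover-Bx` (g16, cell `hodge-nonav`) as
brick B4a-5 of the programme «A₃-TRACE» (stub hN′ = `stub_a3NonCommOdd` of crux K1-B `VeryGeneralSignCommutatorsInHg`,
stmt-HodgeConjecture-19716): the chart hypothesis `Σⱼ (Θ y)ⱼ^{aⱼ} = φ y`, `Θ y₀ = 0` of the weighted-pencil isotopy port
(`WeightedPencil*`, brick 8) for the pencil coordinate `φ` of the chart `x_j ≠ 0` of the regular locus of the universal family.

Along the pencil `f₁ + c·x_j^d` the solved coefficient of `x_j^d` at affine coordinates `y` is `coeff_{x_j^d} f₁ − f₁(ins_j 1 y)`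
(`regChartCoeffVec_pencil_regPowIndex_of_isHomogeneous`), so the pencil coordinate is `φ(y) = −f₁(ins_j 1 y)` (`f₁(e_j) = 0`);
rescaling the coordinates of the `A₃` chart by roots `μⱼ^{aⱼ} = −1` gives:

* `IsSymmetricA3Datum.exists_pencil_A3Chart` — `∃ Θ`, `0 ∈ Θ.source`, `Θ 0 = 0`, `Θ` holomorphic, `Θ`, `Θ.symm` real `C^∞`,
  `Σᵢ (Θ y)ᵢ^{aᵢ} = −f₁(ins_j 1 y)` on `Θ.source`;
* `IsSymmetricA3Datum.exists_pencil_A3Chart_coeff` — the same with the conclusion in the port's currency: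
  `regChartCoeffVec n d j (b'₀, y) (x_j^d) = (b₀)_{x_j^d} + Σᵢ (Θ y)ᵢ^{aᵢ}` for `b₀ = coeffs f₁`, and `Σᵢ (Θ y)ᵢ^{aᵢ} = φ(y)`.

Everything is proved; no definitions, no named facts.  Honest scope: a coordinate change; nothing here says HC or any rung is proved.

## References
* [ArnoldGuseinzadeVarchenko2012] AGZV II, Part I §5.2 (boundary singularity `B₂`).
* [ArnoldGuseinZadeVarchenko1985] AGZV I, §9.6, §11.1 (`A₃ : x⁴ + Σ yᵢ²`).
* [VoisinHodgeII2003] Voisin II, §2.3.1 and §6.2.1 (pencils; the chart of the universal family).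
-/

noncomputable section

open MvPolynomial Set Function Filter
open scoped Topology ContDiff
open Literature.AlgebraicGeometry.Motives Literature.AlgebraicGeometry.Motives.UniversalHypersurface
open Literature.AlgebraicGeometry.HodgeTheory.UniversalHypersurface Literature.Geometry.ComplexAnalytic
open Literature.NumberTheory.Transcendental

namespace Literature.AlgebraicGeometry.HodgeTheory

section HodgeTheory

variable {n d : ℕ} {f₁ g₀ g₂ : MvPolynomial (Fin (n + 2)) ℂ} {j k : Fin (n + 2)} {a : Fin (n + 2) → ℂˣ}

namespace IsSymmetricA3Datum

/-- `e_j + ins_j 0 y = ins_j 1 y`. [folklore] -/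
private theorem single_add_insertNth (j : Fin (n + 2)) (y : Fin (n + 1) → ℂ) :
    (Pi.single j 1 : Fin (n + 2) → ℂ) + Fin.insertNth j (0 : ℂ) y = Fin.insertNth j (1 : ℂ) y := by
  funext l
  refine Fin.succAboveCases j ?_ (fun i => ?_) l
  · simp [Fin.insertNth_apply_same]
  · simp [Fin.insertNth_apply_succAbove, Fin.succAbove_ne]

/-- **The `A₃` chart of the pencil coordinate.**  For forms `f₁, g₀, g₂` of degree `d` on `ℙⁿ⁺¹`, `n ≥ 1`, with
`IsSymmetricA3Datum f₁ g₀ g₂ j k a`, there is an open partial homeomorphism `Θ` of `ℂⁿ⁺¹` with `0 ∈ Θ.source` (the affine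
coordinates of `e_j` in the chart `x_j ≠ 0`), `Θ 0 = 0`, `Θ` complex differentiable and real `C^∞`, `Θ.symm` real `C^∞`,
and `Σᵢ (Θ y)ᵢ^{aᵢ} = −f₁(ins_j 1 y)` on `Θ.source` (`aᵢ = 4` for `i = Fin.last n`, else `2`).
[cite: ArnoldGuseinzadeVarchenko2012, Part I §5.2] [cite: ArnoldGuseinZadeVarchenko1985, §11.1]
[cite: VoisinHodgeII2003, §2.3.1] -/
theorem exists_pencil_A3Chart (hf₁ : f₁.IsHomogeneous d) (hg₀ : g₀.IsHomogeneous d) (hg₂ : g₂.IsHomogeneous d)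
    (hn : 1 ≤ n) (hD : IsSymmetricA3Datum f₁ g₀ g₂ j k a) :
    ∃ Θ : OpenPartialHomeomorph (Fin (n + 1) → ℂ) (Fin (n + 1) → ℂ),
      (0 : Fin (n + 1) → ℂ) ∈ Θ.source ∧ Θ 0 = 0 ∧
      DifferentiableOn ℂ Θ Θ.source ∧ ContDiffOn ℝ ∞ Θ Θ.source ∧ ContDiffOn ℝ ∞ Θ.symm Θ.target ∧
      ∀ y ∈ Θ.source, ∑ i, (Θ y i) ^ (if i = Fin.last n then 4 else 2 : ℕ) =
        -eval (Fin.insertNth j (1 : ℂ) y : Fin (n + 2) → ℂ) f₁ := by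
  classical
  obtain ⟨Θ₀, h0, hΘ₀0, hΘ₀d, hΘ₀cd, hΘ₀scd, hΘ₀F⟩ := hD.exists_A3NormalFormChart hf₁ hg₀ hg₂ hn
  -- roots `μᵢ^{aᵢ} = -1`
  obtain ⟨ζ, hζ⟩ := IsAlgClosed.exists_pow_nat_eq (-1 : ℂ) (by norm_num : 0 < 4)
  have hζ0 : ζ ≠ 0 := by
    rintro rfl
    norm_num at hζ
  obtain ⟨μ, hμ⟩ : ∃ μ : Fin (n + 1) → ℂ, ∀ i, μ i = if i = Fin.last n then ζ else Complex.I := ⟨_, fun i => rfl⟩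
  have hμ0 : ∀ i, μ i ≠ 0 := fun i => by
    rw [hμ]
    split_ifs
    · exact hζ0
    · exact Complex.I_ne_zero
  have hμpow : ∀ i, μ i ^ (if i = Fin.last n then 4 else 2 : ℕ) = -1 := fun i => by
    rw [hμ]
    split_ifs
    · exact hζ
    · exact Complex.I_sq
  -- the diagonal scaling `M y = (μᵢ yᵢ)ᵢ`
  let Mℓ : (Fin (n + 1) → ℂ) ≃ₗ[ℂ] (Fin (n + 1) → ℂ) :=
    { toFun := fun y i => μ i * y i
      invFun := fun y i => (μ i)⁻¹ * y i
      map_add' := fun y y' => by funext i; simp only [Pi.add_apply]; ring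
      map_smul' := fun c y => by funext i; simp only [Pi.smul_apply, smul_eq_mul, RingHom.id_apply]; ring
      left_inv := fun y => by funext i; simp only [inv_mul_cancel_left₀ (hμ0 i)]
      right_inv := fun y => by funext i; simp only [mul_inv_cancel_left₀ (hμ0 i)] }
  let M : (Fin (n + 1) → ℂ) ≃L[ℂ] (Fin (n + 1) → ℂ) := Mℓ.toContinuousLinearEquiv
  have hM : ∀ y i, M y i = μ i * y i := fun y i => rfl
  refine ⟨Θ₀.transHomeomorph M.toHomeomorph, ?_, ?_, ?_, ?_, ?_, ?_⟩
  · simpa using h0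
  · show M (Θ₀ 0) = 0
    rw [hΘ₀0, map_zero]
  · have h : DifferentiableOn ℂ (⇑M ∘ ⇑Θ₀) Θ₀.source := M.differentiable.comp_differentiableOn hΘ₀d
    simpa [OpenPartialHomeomorph.transHomeomorph] using h
  · have h : ContDiffOn ℝ ∞ (⇑M ∘ ⇑Θ₀) Θ₀.source := (M.contDiff.restrict_scalars ℝ).comp_contDiffOn hΘ₀cd
    simpa [OpenPartialHomeomorph.transHomeomorph] using h
  · have htgt : (Θ₀.transHomeomorph M.toHomeomorph).target = M.toHomeomorph.symm ⁻¹' Θ₀.target := by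
      simp [OpenPartialHomeomorph.transHomeomorph]
    have hsymm : ∀ z, (Θ₀.transHomeomorph M.toHomeomorph).symm z = Θ₀.symm (M.symm z) := fun z => rfl
    rw [htgt]
    have h : ContDiffOn ℝ ∞ (fun z => Θ₀.symm (M.symm z)) (M.toHomeomorph.symm ⁻¹' Θ₀.target) :=
      hΘ₀scd.comp (M.symm.contDiff.restrict_scalars ℝ).contDiffOn fun z hz => hz
    exact h.congr fun z _ => hsymm z
  · intro y hy
    have hy' : y ∈ Θ₀.source := by simpa using hy
    have h := hΘ₀F y hy'
    rw [single_add_insertNth] at h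
    show ∑ i, (M (Θ₀ y) i) ^ _ = _
    rw [← h, ← Finset.sum_neg_distrib]
    refine Finset.sum_congr rfl fun i _ => ?_
    rw [hM, mul_pow, hμpow, neg_one_mul]

/-- **The `A₃` chart of the solved coefficient**, in the form consumed by the weighted-pencil port (`WeightedPencil*`): for
`b₀ = coeffs f₁`, `regChartCoeffVec n d j (b'₀, y) (x_j^d) = (b₀)_{x_j^d} + Σᵢ (Θ y)ᵢ^{aᵢ}` on `Θ.source`, and with
`φ(y) = regChartCoeffVec n d j (b'₀, y) (x_j^d) − (b₀)_{x_j^d}` also `Σᵢ (Θ y)ᵢ^{aᵢ} = φ(y)`; here `Θ 0 = 0` at the affine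
coordinates `y₀ = 0` of `e_j`. [cite: ArnoldGuseinzadeVarchenko2012, Part I §5.2] [cite: VoisinHodgeII2003, §2.3.1 and §6.2.1] -/
theorem exists_pencil_A3Chart_coeff (hf₁ : f₁.IsHomogeneous d) (hg₀ : g₀.IsHomogeneous d) (hg₂ : g₂.IsHomogeneous d)
    (hn : 1 ≤ n) (hD : IsSymmetricA3Datum f₁ g₀ g₂ j k a) :
    ∃ Θ : OpenPartialHomeomorph (Fin (n + 1) → ℂ) (Fin (n + 1) → ℂ),
      (0 : Fin (n + 1) → ℂ) ∈ Θ.source ∧ Θ 0 = 0 ∧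
      DifferentiableOn ℂ Θ Θ.source ∧ ContDiffOn ℝ ∞ Θ Θ.source ∧ ContDiffOn ℝ ∞ Θ.symm Θ.target ∧
      (∀ y ∈ Θ.source, regChartCoeffVec n d j
        (Sum.elim (fun m : {m : DegIndex n d // m ≠ regPowIndex n d j} => coeffsOf n d f₁ m.1) y) (regPowIndex n d j) =
          coeffsOf n d f₁ (regPowIndex n d j) + ∑ i, (Θ y i) ^ (if i = Fin.last n then 4 else 2 : ℕ)) ∧
      ∀ y ∈ Θ.source, ∑ i, (Θ y i) ^ (if i = Fin.last n then 4 else 2 : ℕ) = regChartCoeffVec n d j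
        (Sum.elim (fun m : {m : DegIndex n d // m ≠ regPowIndex n d j} => coeffsOf n d f₁ m.1) y) (regPowIndex n d j) -
          coeffsOf n d f₁ (regPowIndex n d j) := by
  obtain ⟨Θ, h0, hΘ0, hΘd, hΘcd, hΘscd, hΘF⟩ := hD.exists_pencil_A3Chart hf₁ hg₀ hg₂ hn
  have hc₀ : coeffsOf n d f₁ (regPowIndex n d j) = MvPolynomial.coeff (Finsupp.single j d) f₁ := rfl
  refine ⟨Θ, h0, hΘ0, hΘd, hΘcd, hΘscd, fun y hy => ?_, fun y hy => ?_⟩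
  · rw [regChartCoeffVec_pencil_regPowIndex_of_isHomogeneous n d j hf₁, hΘF y hy, hc₀]
    ring
  · rw [regChartCoeffVec_pencil_regPowIndex_of_isHomogeneous n d j hf₁, hΘF y hy, hc₀]
    ring

/-- **The `A₃` chart of the pencil coordinate, weight-vector form** (the hypothesis list of the weighted-pencil leaf
`WeightedPencil*` ∕ `A3PencilCircleTransportNotUnipotent`, verbatim): for `n = m + 1` and ANY weight vector `a : Fin (m + 2) → ℕ`
with `a l.castSucc = 2`, `a last = 4`: `∃ Θ`, `0 ∈ Θ.source`, `Θ 0 = 0`, `Θ`, `Θ.symm` real `C^∞`, and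
`Σ_l (Θ y l)^{a l} = −f₁(ins_j 1 y)` on `Θ.source`. [cite: ArnoldGuseinzadeVarchenko2012, Part I §5.2]
[cite: ArnoldGuseinZadeVarchenko1985, §11.1] -/
theorem exists_pencil_A3Chart_of_weights {m d : ℕ} {f₁ g₀ g₂ : MvPolynomial (Fin (m + 1 + 2)) ℂ} {j k : Fin (m + 1 + 2)}
    {ι : Fin (m + 1 + 2) → ℂˣ} (hf₁ : f₁.IsHomogeneous d) (hg₀ : g₀.IsHomogeneous d) (hg₂ : g₂.IsHomogeneous d)
    (hD : IsSymmetricA3Datum f₁ g₀ g₂ j k ι) (a : Fin (m + 2) → ℕ) (h2 : ∀ l : Fin (m + 1), a l.castSucc = 2)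
    (h4 : a (Fin.last (m + 1)) = 4) :
    ∃ Θ : OpenPartialHomeomorph (Fin (m + 2) → ℂ) (Fin (m + 2) → ℂ),
      (0 : Fin (m + 2) → ℂ) ∈ Θ.source ∧ Θ 0 = 0 ∧ ContDiffOn ℝ ∞ Θ Θ.source ∧ ContDiffOn ℝ ∞ Θ.symm Θ.target ∧
      ∀ y ∈ Θ.source, ∑ l, (Θ y l) ^ a l = -MvPolynomial.eval (Fin.insertNth j (1 : ℂ) y : Fin (m + 1 + 2) → ℂ) f₁ := by
  obtain ⟨Θ, h0, hΘ0, -, hΘcd, hΘscd, hΘF⟩ := hD.exists_pencil_A3Chart hf₁ hg₀ hg₂ (Nat.succ_le_succ (Nat.zero_le m))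
  have ha : ∀ l : Fin (m + 2), a l = if l = Fin.last (m + 1) then 4 else 2 := fun l => by
    refine Fin.lastCases ?_ (fun i => ?_) l
    · rw [if_pos rfl, h4]
    · rw [if_neg (Fin.castSucc_lt_last i).ne, h2]
  refine ⟨Θ, h0, hΘ0, hΘcd, hΘscd, fun y hy => ?_⟩
  rw [← hΘF y hy]
  exact Finset.sum_congr rfl fun l _ => by rw [ha]

end IsSymmetricA3Datum

end HodgeTheory

end Literature.AlgebraicGeometry.HodgeTheory

end
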